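import Summits.BirchSwinnertonDyer.Rank1Residual.Additive.X4ThreeVisibleRowShapesThetaFree
import Literature.NumberTheory.EllipticCurves.Fisher2012.HesseFamilyThreeReverseProofs
import HarnessLib

/-!
# The two DUAL batch-1 T-VIS3 rows made A243-FREE: `hF'` discharged by n1011-p02's theorem
# `Fisher2012.thm132rev_threeCongruent_dualHessePencil_holds` (ROW T-F132-3R)
# (cell `b2b-bsdres`, team n1011, ROW T-VIS3-TH FILE 2c; seat p07 (gen 10); skeleton cells/n1011/skel/T-VIS3-TH.md)

HONEST FRAMING (cell `b2b-bsdres`, run/shared/lean/b2b/bsd-rank1-residual/, verbatim in every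
file): the goal of the cell is to DELETE the COMBINATION-SHAPED residual classes of the
Birch–Swinnerton-Dyer formula for ALL analytic-rank `≤ 1` elliptic curves over `ℚ` — "full BSD
formula for every rank `≤ 1` curve in class `C`" assembled STRICTLY from published theorems — so
that the rank-`≤ 1` remainder becomes exactly the CONSTRUCTION-SHAPED classes, which are TYPED
(missing-input `Prop`s), NOT attempted. This is not "finishing BSD". Team n1011 (N11 = X4 ∧ `p = 3`):
research route; RECORD theorems only — NO definition, NO new named fact, NO `sorry`; closes nothing
beyond the displayed binders; nothing booked; no mark / label / count moved.

## What

`bsdp3_visHesse_v15129e1` and `bsdp3_visHesse_v19809d1` (FILE 2) carry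
`(hF' : thm132rev_threeCongruent_dualHessePencil)` because their partners (15129d1, 59427a1; isogeny
classes of size 1) are only ANTI-symplectically `3`-congruent (dual Hesse pencil). With the registered
fact A243 now a THEOREM of the tree (`Fisher2012.thm132rev_threeCongruent_dualHessePencil_holds`,
n1011-p02 ROW T-F132-3R), the binder is discharged BY NAME: **`bsdp3_visHesse_v15129e1_a243free`**,
**`bsdp3_visHesse_v19809d1_a243free`** — binders left = the named facts of the (M)/(G) chain + `hr` +
`hq/hv` (+ `D/hc` on 19809d1), exactly as on the five direct rows. Closes nothing beyond them.

References: [Fisher2012Hessian] Thm. 13.2 / §13; [CremonaMazur2000] §3; FILE 2 of this row.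
-/

set_option autoImplicit false

noncomputable section

open scoped Classical NumberField
open IsDedekindDomain NumberField WeierstrassCurve Rat.HeightOneSpectrum
  Literature.NumberTheory.EllipticCurves Literature.NumberTheory.EllipticCurves.ModularForms
  Literature.NumberTheory.EllipticCurves.Rank1Residual
  Literature.NumberTheory.EllipticCurves.Rank1Residual.Typed
  Literature.NumberTheory.EllipticCurves.Fisher2012
  Literature.NumberTheory.GaloisRepresentations
  Summit.BirchSwinnertonDyer.BirchSwinnertonDyer.Rank1Residual.IntModel
  Summit.BirchSwinnertonDyer.BirchSwinnertonDyer.Rank1Residual.X11RankOne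
  Summit.BirchSwinnertonDyer.BirchSwinnertonDyer.Rank2Observatory.Tam
  Summit.BirchSwinnertonDyer.Rank1Residual.GaloisImage

namespace Summit.BirchSwinnertonDyer.Rank1Residual.Additive

/-- **T-VIS3 row `15129e1` (dual partner `15129d1`), A243-FREE**: FILE 2's `bsdp3_visHesse_v15129e1` with `hF'`
discharged by `Fisher2012.thm132rev_threeCongruent_dualHessePencil_holds`. Binders left = named facts +
`hr` + `hq/hv`; closes nothing beyond them; nothing booked.
[cite: CremonaMazur2000, §3 and Table 1] [cite: Fisher2012Hessian, §13 (analogue of Thm. 13.2 for X_E^-(3))] -/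
theorem bsdp3_visHesse_v15129e1_a243free
    (hKatoS : Kato2004.rankZero_padicValNat_sha_le_sub_localTamagawa_of_additive_potGood_of_imageContainsSL2)
    (hDel : Delbourgo1998.prop4_rankZero_pow_dvd_constantCoeff)
    (hGZK : rank_eq_analyticRank_of_analyticRank_le_one) (hmod : hasEntireLFunction_rat)
    (hmodD : nonempty_modularParametrizationData)
    (hKatoχ : Wuthrich2014.kato_halfEigenCharIdeal_dvd_cyclotomicPrime_of_surjective)
    (hCT : exists_casselsTate_pairing (K := ℚ))
    (W : WeierstrassCurve ℚ) [W.IsElliptic] [W.IsGloballyMinimal]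
    (hI : integralModelInt W = ⟨0, 0, 1, -156333, -25414619⟩)
    (hr : W.analyticRank = 0)
    {q : ℚ} (hq : shaAn W = (q : ℂ)) (hv : padicValRat 3 q ≤ 2) :
    haveI : Fact (Nat.Prime 3) := ⟨Nat.prime_three⟩
    BSDp W 3 :=
  bsdp3_visHesse_v15129e1 thm132rev_threeCongruent_dualHessePencil_holds hKatoS hDel hGZK hmod hmodD hKatoχ hCT W hI hr hq hv

/-- **T-VIS3 row `19809d1` (dual partner `59427a1`), A243-FREE**: FILE 2's `bsdp3_visHesse_v19809d1` with `hF'`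
discharged by `Fisher2012.thm132rev_threeCongruent_dualHessePencil_holds`. Binders left = named facts +
`hr` + `hq/hv` + `D/hc`; closes nothing beyond them; nothing booked.
[cite: CremonaMazur2000, §3 and Table 1] [cite: Fisher2012Hessian, §13 (analogue of Thm. 13.2 for X_E^-(3))] -/
theorem bsdp3_visHesse_v19809d1_a243free
    (hKato : Kato2004.rankZero_padicValNat_sha_le_of_additive_potGood_of_imageContainsSL2)
    (hCT : exists_casselsTate_pairing (K := ℚ))
    (hGZK : rank_eq_analyticRank_of_analyticRank_le_one) (hmod : hasEntireLFunction_rat)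
    (W : WeierstrassCurve ℚ) [W.IsElliptic] [W.IsGloballyMinimal]
    (hI : integralModelInt W = ⟨0, 0, 1, -393, -2999⟩)
    (hr : W.analyticRank = 0)
    {N : ℕ} [NeZero N] (D : ModularParametrizationData W N) (hc : ¬ ((3 : ℕ) : ℤ) ∣ D.maninConstant)
    {q : ℚ} (hq : shaAn W = (q : ℂ)) (hv : padicValRat 3 q ≤ 2) :
    haveI : Fact (Nat.Prime 3) := ⟨Nat.prime_three⟩
    BSDp W 3 :=
  bsdp3_visHesse_v19809d1 thm132rev_threeCongruent_dualHessePencil_holds hKato hCT hGZK hmod W hI hr D hc hq hv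

end Summit.BirchSwinnertonDyer.Rank1Residual.Additive

end
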